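/-
Copyright: lit-balaban cell, Phase-2 proof seat p24 (gen 23).  Released under Apache 2.0 license as described in the
file LICENSE.
-/
import Literature.MathematicalPhysics.QuantumFieldTheory.Balaban1983to89.B4Eq246SummableSolution
import Literature.MathematicalPhysics.QuantumFieldTheory.Balaban1983to89.B4Reflection242
import Literature.MathematicalPhysics.QuantumFieldTheory.Balaban1983to89.B4Eq244L2Unique

/-!
# `Balaban1983to89.B4Eq247TransformGQ` — [Balaban1983RegularityDecay] p. 585, **(2.47)** AS PRINTED for a general summable `g`,
# and `G_jQ_j^*` REALISED BY THE KERNEL (2.48): `(G_jQ_j^*g)(x) = Σ_y (G_jQ_j^*)(x,y) g(y)` is the unique summable solution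
# of (2.44) with `f = Q_j^*g`

statement-level skeleton of published theorems with citation tags; proofs where landed; nothing here is a claim about
the Yang–Mills mass gap

CITATION HEADER.  T. Bałaban, *Regularity and decay of lattice Green's functions*, Commun. Math. Phys. **89** (1983)
571–597, doi:10.1007/bf01214744 [Balaban1983RegularityDecay] (cell paper B4; held text
`paper:balaban1983-cmp89-regularity-decay`, journal page = PDF page + 570), p. 584–585 [PDF 14–15]; render
`pub-balaban/b2b-balaban-ref1/pages/1983-cmp89-regularity-decay/1983-cmp89-regularity-decay-p015-x2.png` read as an image by
this seat (unit `lit-balaban-p24` gen 23; HOME `run/shared/lean/pub/lit-balaban/`; SKELETON row **B4.Eq2.43** = displays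
(2.43)–(2.48); companion of `B4Eq243Transform`/`B4Eq243TransformSummable` (2.43), `B4Eq245Aliasing` (2.44) ⇒ (2.45),
`B4Eq246Fibre`/`B4Eq246SummableSolution` (2.46) and `B4Green244` (2.48)).

WHAT IS PRINTED (p. 585, verbatim).  «To calculate G_jQ_j^*, we take f = Q_j^*g in this formula, g is a function on the unit
lattice, f̃(p) = u_j(p)g̃(p′), g̃(p′) = Σ_y e^{−ip′·y}g(y), and we get
  (G_jQ_j^*g)~(p′+l) = (u_j(p′+l)/Δ^ξ(p′+l)) · 1/(a_jΣ_{l′}|u_j(p′+l′)|²/Δ^ξ(p′+l′) + 1) · g̃(p′).   (2.47)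
From this we obtain finally the following formula for (G_jQ_j^*)(x, y),
  (G_jQ_j^*)(x,y) = (2π)^{−d}∫_{|p′|≤π}dp′ Σ_l e^{i(p′+l)·(x−y)} · 1/(a_jΣ_{l′}|u_j(p′+l′)|²/Δ^ξ(p′+l′) + 1) · u_j(p′+l)/Δ^ξ(p′+l).
  (2.48)»

WHAT THIS MODULE PROVES (kernel-checked; 1 definition WITH BODY + theorems; 0 `sorry`; 0 `Prop` facts; axioms standard).
Dictionary of `B4Green244` (`u_j(p′+2πk) = V n k p′`, `Δ^ξ(p′+2πk) = DeltaXi n m² (shift n k p′)`, the bracket of (2.46)/(2.47) =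
`B4Eq246Fibre.bracket246`, `g̃ = B4Eq245Aliasing.uft g`, `(Q_j^*g)(ξz) = g(⌊z/n⌋)`, `(G_jQ_j^*)(ξz, y) = B4Green244.K n a m² z y`):
* the fibre algebra (2.46) ⇒ (2.47) (for `f̃(p′+l′) = u_j(p′+l′)·c` the right side of (2.46) collapses to
  `(u_j(p′+l)/Δ^ξ(p′+l))·bracket⁻¹·c`) is the B4 owner's `B4Eq246Fibre.sol246_blockConst` (r01, v1.1), taken BY NAME;
* `ftSum_Qstar` — «f = Q_j^*g … f̃(p) = u_j(p)g̃(p′)» for EVERY `g ∈ ℓ¹(ℤ^d)` (the summability feeder `summable_norm_comp_coarse`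
  for `B4Eq245Aliasing.ftSum_blockConst`);
* **`ftSum_fibre_GQ`** — **(2.47) AS PRINTED**: if `(−Δ^ξ + m² + aQ_j^*Q_j)φ₀ = Q_j^*g` with `φ₀` summable on the fine lattice and
  `g ∈ ℓ¹(ℤ^d)` (`m² > 0`, `a ≥ 0`), then `φ̃₀(p′+l) = (u_j(p′+l)/Δ^ξ(p′+l))·(a_jΣ_{l′}|u_j(p′+l′)|²/Δ^ξ(p′+l′) + 1)⁻¹·g̃(p′)` at every
  real `p′` and every shift `l`;
* `GQ n a m² g z := Σ'_y K(z,y) g(y)` — **`G_jQ_j^*` APPLIED TO `g` THROUGH THE KERNEL (2.48)** (absolutely convergent for bounded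
  `K`, `summable_K_mul`); **`summable_norm_GQ`**: `GQ g ∈ ℓ¹` for `g ∈ ℓ¹` (the exponential decay `B4Green244.K_decay` of
  Lemma 2.4 and `Σ_v e^{−κ|v|_∞} < ∞`, `B4Reflection242.summable_exp_supNorm_sub`); **`opD_GQ`**: it SOLVES (2.44) with
  `f = Q_j^*g` (`B4Green244.green244` summed against `g`, the finite stencil `opD_eq_stencil` commuting with the series);
* **`GQ_eq_of_solution`** (`m² ≥ 0`, `a > 0`; dimension written `d + 1 ≥ 1` as in `K_decay`) — every summable solution of (2.44)
  with `f = Q_j^*g` IS `GQ g` (`B4Eq246SummableSolution.solution_unique_of_nonneg`); **`ftSum_fibre_GQ_kernel`** (`m² > 0`) — the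
  transform of `GQ g` is (2.47); so the object whose kernel (2.48) the tree certified (`green244`, `K_eq`, `K_decay`) is the
  operator `G_jQ_j^*` of the printed sentence, for general summable data; `ftSum_fibre_GQ_of_generic` — (2.47) for `m² ≥ 0` at
  every generic `p′ ∉ (2πℤ)^d` (where its right-hand side is defined).

DICTIONARY / HONEST SCOPE.  (i) `a_j ↦ a` real; (2.47) at EVERY real `p′` needs `m² > 0` (for `m² = 0` it is proved at the
generic `p′`, its printed right side being undefined on `(2πℤ)^d`), `a ≥ 0`; the kernel statements need `a > 0`, `m² ≥ 0`
(`green244`/`K_decay`).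
(ii) `g ∈ ℓ¹(ℤ^d)` (print: «g is a function on the unit lattice», no class); `φ₀ ∈ ℓ¹`.  (iii) (2.48) itself — the kernel as the
zone integral — is `B4Green244.K_eq` and is not re-proved; here `K` is only summed against `g`.  (iv) Fibre representatives
`k_μ ∈ {0,…,n−1}`; scalar fields.  Value = kernel certificate of (2.47) and of the operator reading of (2.48) for general data;
NOT summit progress.

v1.1 (append-only, same seat): §4 — **`GQ_eq_of_solution_l2`**: the identification with the WEAKEST class, every SQUARE-summable
solution of (2.44) with block source `g ∈ ℓ¹` is `GQ g` (`m² ≥ 0`, `a > 0`; `B4Eq244L2Unique.opD_injective_l2`, positivity instead of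
the transform); **`ftSum_fibre_GQ_kernel_of_generic`**: the transform of `GQ g` is (2.47) for all `m² ≥ 0` at every generic
`p′ ∉ (2πℤ)^{d+1}`.
-/

namespace Literature.MathematicalPhysics.QuantumFieldTheory.Balaban1983to89.B4Eq247TransformGQ

open Complex Finset MeasureTheory
open Literature.MathematicalPhysics.QuantumFieldTheory.Balaban1983to89.B4Strip
open Literature.MathematicalPhysics.QuantumFieldTheory.Balaban1983to89.B4ContourShift
open Literature.MathematicalPhysics.QuantumFieldTheory.Balaban1983to89.B4StripSums
open Literature.MathematicalPhysics.QuantumFieldTheory.Balaban1983to89.B4Green244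
open Literature.MathematicalPhysics.QuantumFieldTheory.Balaban1983to89.B4Eq243TransformSummable
open Literature.MathematicalPhysics.QuantumFieldTheory.Balaban1983to89.B4Eq245Aliasing
open Literature.MathematicalPhysics.QuantumFieldTheory.Balaban1983to89.B4Eq246Fibre
open Literature.MathematicalPhysics.QuantumFieldTheory.Balaban1983to89.B4Eq246SummableSolution
open Literature.MathematicalPhysics.QuantumFieldTheory.Balaban1983to89.B4Reflection242 (summable_exp_supNorm_sub)
open scoped Real ComplexConjugate

noncomputable section

variable {d : ℕ}

/-! ### §1 «f = Q_j^*g, f̃(p) = u_j(p)g̃(p′)» for every `g ∈ ℓ¹(ℤ^d)` -/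

/-- a summable function on the unit lattice, read at the block label, is summable on the fine lattice (each value repeated
`n^d` times). [cite: Balaban1983RegularityDecay, (2.47) p.585, dictionary] -/
theorem summable_norm_comp_coarse (n : ℕ) [NeZero n] {g : (Fin d → ℤ) → ℂ} (hg : Summable fun y => ‖g y‖) :
    Summable fun z => ‖g (coarse n z)‖ := by
  rw [← (blockEquiv n).summable_iff]
  have h3 : (fun z => ‖g (coarse n z)‖) ∘ blockEquiv n = fun yτ : (Fin d → ℤ) × (Fin d → Fin n) => ‖g yτ.1‖ := by
    funext yτ
    simp only [Function.comp, blockEquiv, Equiv.coe_fn_mk, coarse_finePt]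
  rw [h3]
  refine (summable_prod_of_nonneg (fun yτ => norm_nonneg _)).mpr ⟨fun y => (hasSum_fintype _).summable, ?_⟩
  simp_rw [tsum_fintype, Finset.sum_const, Finset.card_univ, nsmul_eq_mul]
  exact hg.mul_left _

/-- **p. 585, «we take f = Q_j^*g …, f̃(p) = u_j(p)g̃(p′)»**, for every `g ∈ ℓ¹(ℤ^d)`, every real `p′` and every shift `l = 2πk`:
`(Q_j^*g)~(p′+l) = u_j(p′+l)·g̃(p′)`. [cite: Balaban1983RegularityDecay, (2.47) p.585] -/
theorem ftSum_Qstar (n : ℕ) [NeZero n] {g : (Fin d → ℤ) → ℂ} (hg : Summable fun y => ‖g y‖) (p : Fin d → ℝ)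
    (k : Fin d → Fin n) :
    ftSum n (fun z => g (coarse n z)) (shift n k (ofRealVec p)) = V n k (ofRealVec p) * uft g (ofRealVec p) :=
  ftSum_blockConst n k (summable_ftTerm_ofRealVec n (summable_norm_comp_coarse n hg) p)

/-! ### §2 (2.47) AS PRINTED for every summable solution with a block source -/

/-- **(2.47) AS PRINTED.**  If `(−Δ^ξ + m² + aQ_j^*Q_j)φ₀ = Q_j^*g` on `ξℤ^d` with `φ₀` summable and `g ∈ ℓ¹(ℤ^d)` (`m² > 0`,
`a ≥ 0`), then at every real `p′` and every shift `l = 2πk`: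
`φ̃₀(p′+l) = (u_j(p′+l)/Δ^ξ(p′+l)) · (a_jΣ_{l′}|u_j(p′+l′)|²/Δ^ξ(p′+l′) + 1)⁻¹ · g̃(p′)`.
[cite: Balaban1983RegularityDecay, (2.47) p.585] -/
theorem ftSum_fibre_GQ (n : ℕ) [NeZero n] {a m2 : ℝ} (ha : 0 ≤ a) (hm : 0 < m2) {φ₀ g : (Fin d → ℤ) → ℂ}
    (hφ : Summable fun z => ‖φ₀ z‖) (hg : Summable fun y => ‖g y‖) (h : ∀ z, opD n a m2 φ₀ z = g (coarse n z))
    (p : Fin d → ℝ) (k : Fin d → Fin n) :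
    ftSum n φ₀ (shift n k (ofRealVec p))
      = V n k (ofRealVec p) / DeltaXi n m2 (shift n k (ofRealVec p))
        * (bracket246 (a : ℂ) (fun k' : Fin d → Fin n => DeltaXi n m2 (shift n k' (ofRealVec p)))
            (fun k' => V n k' (ofRealVec p)))⁻¹
        * uft g (ofRealVec p) := by
  have hfib := congrFun (ftSum_fibre_eq_sol246_of_pos n ha hm hφ (f := fun z => g (coarse n z)) h p) k
  rw [hfib]
  have hF : (fun k' : Fin d → Fin n => ftSum n (fun z => g (coarse n z)) (shift n k' (ofRealVec p)))
      = fun k' => V n k' (ofRealVec p) * uft g (ofRealVec p) := funext fun k' => ftSum_Qstar n hg p k'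
  rw [hF, sol246_blockConst _ _ _ _ (bracket246_ne_zero_of_pos n ha hm p)]

/-- **(2.47) at a GENERIC reduced momentum for all `m² ≥ 0`** (`a ≥ 0`): the same identity whenever some coordinate of `p′`
lies outside `2πℤ` (then every `Δ^ξ(p′+l′) > 0`; at `m² = 0` and `p′ ∈ (2πℤ)^d` the printed right-hand side is undefined).
[cite: Balaban1983RegularityDecay, (2.47) p.585] -/
theorem ftSum_fibre_GQ_of_generic (n : ℕ) [NeZero n] {a m2 : ℝ} (ha : 0 ≤ a) (hm : 0 ≤ m2) {φ₀ g : (Fin d → ℤ) → ℂ}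
    (hφ : Summable fun z => ‖φ₀ z‖) (hg : Summable fun y => ‖g y‖) (h : ∀ z, opD n a m2 φ₀ z = g (coarse n z))
    {p : Fin d → ℝ} {μ : Fin d} (hp : ∀ m : ℤ, p μ ≠ 2 * π * m) (k : Fin d → Fin n) :
    ftSum n φ₀ (shift n k (ofRealVec p))
      = V n k (ofRealVec p) / DeltaXi n m2 (shift n k (ofRealVec p))
        * (bracket246 (a : ℂ) (fun k' : Fin d → Fin n => DeltaXi n m2 (shift n k' (ofRealVec p)))
            (fun k' => V n k' (ofRealVec p)))⁻¹
        * uft g (ofRealVec p) := by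
  have hpos : ∀ k' : Fin d → Fin n, 0 < DeltaXir n m2 (shiftr n k' p) :=
    fun k' => deltaXir_shiftr_pos_of_not_mem n hm hp k'
  have hΔ : ∀ k' : Fin d → Fin n, DeltaXi n m2 (shift n k' (ofRealVec p)) ≠ 0 := by
    intro k' h0
    have := hpos k'
    rw [shift_ofReal, DeltaXi_ofReal, Complex.ofReal_eq_zero] at h0
    linarith
  have hB := bracket246_ne_zero_of_deltaXir_pos n ha p hpos
  have hfib := congrFun (ftSum_fibre_eq_sol246 n a m2 hφ (f := fun z => g (coarse n z)) h p hΔ hB) k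
  rw [hfib]
  have hF : (fun k' : Fin d → Fin n => ftSum n (fun z => g (coarse n z)) (shift n k' (ofRealVec p)))
      = fun k' => V n k' (ofRealVec p) * uft g (ofRealVec p) := funext fun k' => ftSum_Qstar n hg p k'
  rw [hF, sol246_blockConst _ _ _ _ hB]

/-! ### §3 `G_jQ_j^*` through the kernel (2.48): the superposition `Σ_y K(·,y)g(y)` -/

/-- **`G_jQ_j^*g` VIA THE KERNEL (2.48)**: `(G_jQ_j^*g)(ξz) = Σ_y (G_jQ_j^*)(ξz, y) g(y)` with `(G_jQ_j^*)(ξz,y) = B4Green244.K n a m² z y`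
(a `tsum` over the unit lattice; absolutely convergent for `g ∈ ℓ¹` since `K` is bounded, `summable_K_mul`).
[cite: Balaban1983RegularityDecay, (2.47)–(2.48) p.585] -/
def GQ (n : ℕ) [NeZero n] (a m2 : ℝ) (g : (Fin d → ℤ) → ℂ) (z : Fin d → ℤ) : ℂ := ∑' y, K n a m2 z y * g y

/-- a uniform bound and the exponential decay of `K` in the block distance, from Lemma 2.4 (`B4Green244.K_decay`), at fixed
`a > 0`, `m² ≥ 0`. [cite: Balaban1983RegularityDecay, Lemma 2.4 (2.35) p.582, (2.48) p.585] -/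
theorem exists_K_bound (a m2 : ℝ) (ha : 0 < a) (hm : 0 ≤ m2) :
    ∃ κ M : ℝ, 0 < κ ∧ 0 ≤ M ∧ ∀ (n : ℕ) [NeZero n] (z y : Fin (d + 1) → ℤ),
      ‖K n a m2 z y‖ ≤ M * Real.exp (-(κ * supNorm (coarse n z - y))) := by
  obtain ⟨κ, M, hκ, hM, h⟩ := K_decay d a a m2 ha
  exact ⟨κ, M, hκ, hM, fun n _ z y => h n a m2 le_rfl le_rfl hm le_rfl z y⟩

/-- the series `Σ_y K(z,y)g(y)` converges absolutely for `g ∈ ℓ¹` (`a > 0`, `m² ≥ 0`). [cite: Balaban1983RegularityDecay, (2.48) p.585] -/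
theorem summable_K_mul (n : ℕ) [NeZero n] {a m2 : ℝ} (ha : 0 < a) (hm : 0 ≤ m2) {g : (Fin (d + 1) → ℤ) → ℂ}
    (hg : Summable fun y => ‖g y‖) (z : Fin (d + 1) → ℤ) : Summable fun y => ‖K n a m2 z y * g y‖ := by
  obtain ⟨κ, M, hκ, hM, hK⟩ := exists_K_bound (d := d) a m2 ha hm
  refine Summable.of_nonneg_of_le (fun y => norm_nonneg _) (fun y => ?_) (hg.mul_left M)
  rw [norm_mul]
  refine mul_le_mul_of_nonneg_right ((hK n z y).trans ?_) (norm_nonneg _)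
  have : Real.exp (-(κ * supNorm (coarse n z - y))) ≤ 1 := by
    rw [Real.exp_le_one_iff]
    have := supNorm_nonneg (coarse n z - y)
    nlinarith
  nlinarith

/-- **`G_jQ_j^*g ∈ ℓ¹` for `g ∈ ℓ¹`** (`a > 0`, `m² ≥ 0`): `Σ_z |(G_jQ_j^*g)(ξz)| < ∞` — the exponential decay of the kernel
(Lemma 2.4) makes `G_jQ_j^*` bounded on `ℓ¹`. [cite: Balaban1983RegularityDecay, Lemma 2.4 (2.35) p.582, (2.48) p.585] -/
theorem summable_norm_GQ (n : ℕ) [NeZero n] {a m2 : ℝ} (ha : 0 < a) (hm : 0 ≤ m2) {g : (Fin (d + 1) → ℤ) → ℂ}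
    (hg : Summable fun y => ‖g y‖) : Summable fun z => ‖GQ n a m2 g z‖ := by
  obtain ⟨κ, M, hκ, hM, hK⟩ := exists_K_bound (d := d) a m2 ha hm
  -- the majorant `H(x) = Σ_y e^{−κ|x−y|} |g(y)|` is summable over the unit lattice (ℓ¹ ⋆ ℓ¹ ⊂ ℓ¹)
  set E : (Fin (d + 1) → ℤ) → ℝ := fun v => Real.exp (-(κ * supNorm v)) with hE
  have hEs : Summable E := by
    have := summable_exp_supNorm_sub hκ (0 : Fin (d + 1) → ℤ)
    simpa [hE] using this
  have hpair : Summable fun vy : (Fin (d + 1) → ℤ) × (Fin (d + 1) → ℤ) => E vy.1 * ‖g vy.2‖ :=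
    hEs.mul_of_nonneg hg (fun v => (Real.exp_pos _).le) (fun y => norm_nonneg _)
  -- re-index `(v, y) ↦ (v + y, y)`
  let σ : (Fin (d + 1) → ℤ) × (Fin (d + 1) → ℤ) ≃ (Fin (d + 1) → ℤ) × (Fin (d + 1) → ℤ) :=
    { toFun := fun vy => (vy.1 + vy.2, vy.2)
      invFun := fun xy => (xy.1 - xy.2, xy.2)
      left_inv := fun vy => by simp
      right_inv := fun xy => by simp }
  have hpair' : Summable fun xy : (Fin (d + 1) → ℤ) × (Fin (d + 1) → ℤ) => E (xy.1 - xy.2) * ‖g xy.2‖ := by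
    have : (fun xy : (Fin (d + 1) → ℤ) × (Fin (d + 1) → ℤ) => E (xy.1 - xy.2) * ‖g xy.2‖)
        = (fun vy => E vy.1 * ‖g vy.2‖) ∘ σ.symm := by
      funext xy; rfl
    rw [this]
    exact σ.symm.summable_iff.mpr hpair
  have hH : Summable fun x : Fin (d + 1) → ℤ => ∑' y, E (x - y) * ‖g y‖ := hpair'.prod
  -- `Σ_z H(⌊z/n⌋) < ∞`
  have hHc : Summable fun z : Fin (d + 1) → ℤ => ∑' y, E (coarse n z - y) * ‖g y‖ := by
    have hnn : ∀ x, 0 ≤ ∑' y, E (x - y) * ‖g y‖ := fun x =>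
      tsum_nonneg fun y => mul_nonneg (Real.exp_pos _).le (norm_nonneg _)
    have h1 : Summable fun z : Fin (d + 1) → ℤ => ‖((∑' y, E (coarse n z - y) * ‖g y‖ : ℝ) : ℂ)‖ := by
      refine summable_norm_comp_coarse n (g := fun x => ((∑' y, E (x - y) * ‖g y‖ : ℝ) : ℂ)) ?_
      simpa [Complex.norm_real, Real.norm_of_nonneg (hnn _)] using hH
    simpa [Complex.norm_real, Real.norm_of_nonneg (hnn _)] using h1
  refine Summable.of_nonneg_of_le (fun z => norm_nonneg _) (fun z => ?_) (hHc.mul_left M)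
  -- `|GQ g (z)| ≤ Σ_y |K(z,y)||g(y)| ≤ M Σ_y e^{−κ|⌊z/n⌋−y|}|g(y)|`
  have hs := summable_K_mul n ha hm hg z
  calc ‖GQ n a m2 g z‖ ≤ ∑' y, ‖K n a m2 z y * g y‖ := norm_tsum_le_tsum_norm hs
    _ ≤ ∑' y, M * (E (coarse n z - y) * ‖g y‖) := by
        refine hs.tsum_le_tsum (fun y => ?_) ((hpair'.prod_factor (coarse n z)).mul_left M)
        rw [norm_mul, ← mul_assoc]
        exact mul_le_mul_of_nonneg_right (hK n z y) (norm_nonneg _)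
    _ = M * ∑' y, E (coarse n z - y) * ‖g y‖ := tsum_mul_left

/-- **`G_jQ_j^*g` SOLVES (2.44) WITH `f = Q_j^*g`**: `(−Δ^ξ + m² + aQ_j^*Q_j)(Σ_y K(·,y)g(y))(z) = g(⌊z/n⌋)` for `g ∈ ℓ¹`, `a > 0`,
`m² ≥ 0` (`B4Green244.green244`: `D K(·,y) = 1_{B(y)}`, summed against `g`; the finite stencil commutes with the series).
[cite: Balaban1983RegularityDecay, (2.44) p.584, (2.47)–(2.48) p.585] -/
theorem opD_GQ (n : ℕ) [NeZero n] {a m2 : ℝ} (ha : 0 < a) (hm : 0 ≤ m2) {g : (Fin (d + 1) → ℤ) → ℂ}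
    (hg : Summable fun y => ‖g y‖) (z : Fin (d + 1) → ℤ) :
    opD n a m2 (GQ n a m2 g) z = g (coarse n z) := by
  have hn : 1 ≤ n := Nat.pos_of_ne_zero (NeZero.ne n)
  rw [opD_eq_stencil]
  simp only [GQ]
  have hsum : ∀ i : B4Green244.Idx (d + 1) n, Summable fun y => K n a m2 (stp n z i) y * g y :=
    fun i => (summable_K_mul n ha hm hg (stp n z i)).of_norm
  have h1 : ∑ i : B4Green244.Idx (d + 1) n, stc (d + 1) n a m2 i * ∑' y, K n a m2 (stp n z i) y * g y
      = ∑' y, ∑ i : B4Green244.Idx (d + 1) n, stc (d + 1) n a m2 i * (K n a m2 (stp n z i) y * g y) := by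
    rw [Summable.tsum_finsetSum (fun i _ => (hsum i).mul_left _)]
    refine Finset.sum_congr rfl fun i _ => ?_
    rw [tsum_mul_left]
  rw [h1]
  have h2 : ∀ y, ∑ i : B4Green244.Idx (d + 1) n, stc (d + 1) n a m2 i * (K n a m2 (stp n z i) y * g y)
      = (if coarse n z = y then 1 else 0) * g y := by
    intro y
    rw [← green244 n hn a m2 ha hm z y, opD_eq_stencil, Finset.sum_mul]
    refine Finset.sum_congr rfl fun i _ => ?_
    ring
  simp_rw [h2]
  rw [tsum_eq_single (coarse n z) (fun y hy => by rw [if_neg (Ne.symm hy), zero_mul]), if_pos rfl, one_mul]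

/-- **EVERY SUMMABLE SOLUTION OF (2.44) WITH A BLOCK SOURCE IS `G_jQ_j^*g`** (`m² ≥ 0`, `a > 0`): if
`(−Δ^ξ + m² + aQ_j^*Q_j)φ₀ = Q_j^*g` with `φ₀` summable and `g ∈ ℓ¹`, then `φ₀ = Σ_y K(·,y)g(y)`.
[cite: Balaban1983RegularityDecay, (2.44)–(2.46) p.584, (2.47)–(2.48) p.585] -/
theorem GQ_eq_of_solution (n : ℕ) [NeZero n] {a m2 : ℝ} (ha : 0 < a) (hm : 0 ≤ m2) {φ₀ g : (Fin (d + 1) → ℤ) → ℂ}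
    (hφ : Summable fun z => ‖φ₀ z‖) (hg : Summable fun y => ‖g y‖) (h : ∀ z, opD n a m2 φ₀ z = g (coarse n z)) :
    φ₀ = GQ n a m2 g :=
  solution_unique_of_nonneg n (Nat.succ_pos d) ha.le hm hφ (summable_norm_GQ n ha hm hg)
    fun z => by rw [h z, opD_GQ n ha hm hg z]

/-- **(2.47) FOR THE KERNEL OBJECT**: the transform of `G_jQ_j^*g = Σ_y K(·,y)g(y)` is the printed right-hand side of (2.47),
for every `g ∈ ℓ¹(ℤ^{d+1})`, every real `p′`, every shift `l` (`m² > 0`, `a > 0`) — the operator whose kernel (2.48) the tree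
certified is the `G_jQ_j^*` of the printed derivation. [cite: Balaban1983RegularityDecay, (2.47)–(2.48) p.585] -/
theorem ftSum_fibre_GQ_kernel (n : ℕ) [NeZero n] {a m2 : ℝ} (ha : 0 < a) (hm : 0 < m2) {g : (Fin (d + 1) → ℤ) → ℂ}
    (hg : Summable fun y => ‖g y‖) (p : Fin (d + 1) → ℝ) (k : Fin (d + 1) → Fin n) :
    ftSum n (GQ n a m2 g) (shift n k (ofRealVec p))
      = V n k (ofRealVec p) / DeltaXi n m2 (shift n k (ofRealVec p))
        * (bracket246 (a : ℂ) (fun k' : Fin (d + 1) → Fin n => DeltaXi n m2 (shift n k' (ofRealVec p)))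
            (fun k' => V n k' (ofRealVec p)))⁻¹
        * uft g (ofRealVec p) :=
  ftSum_fibre_GQ n ha.le hm (summable_norm_GQ n ha hm.le hg) hg (opD_GQ n ha hm.le hg) p k

/-! ### §4 (v1.1) The weakest class: square-summable solutions; (2.47) for the kernel object at `m² ≥ 0` -/

/-- **EVERY SQUARE-SUMMABLE SOLUTION OF (2.44) WITH A BLOCK SOURCE IS `G_jQ_j^*g`** (`m² ≥ 0`, `a > 0`): if
`(−Δ^ξ + m² + aQ_j^*Q_j)φ₀ = Q_j^*g` with `Σ_z|φ₀(z)|² < ∞` and `g ∈ ℓ¹`, then `φ₀ = Σ_y K(·,y)g(y)` — by the injectivity of the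
operator on `ℓ²` (`B4Eq244L2Unique.opD_injective_l2`; `GQ g ∈ ℓ¹ ⊂ ℓ²`). [cite: Balaban1983RegularityDecay, (2.44) p.584, (2.47)–(2.48) p.585] -/
theorem GQ_eq_of_solution_l2 (n : ℕ) [NeZero n] {a m2 : ℝ} (ha : 0 < a) (hm : 0 ≤ m2) {φ₀ g : (Fin (d + 1) → ℤ) → ℂ}
    (hφ : Summable fun z => ‖φ₀ z‖ ^ 2) (hg : Summable fun y => ‖g y‖) (h : ∀ z, opD n a m2 φ₀ z = g (coarse n z)) :
    φ₀ = GQ n a m2 g := by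
  have hGQ1 := summable_norm_GQ n ha hm hg
  -- `ℓ¹ ⊂ ℓ²` for `GQ g`
  have hGQ2 : Summable fun z => ‖GQ n a m2 g z‖ ^ 2 := by
    have h1 : ∀ᶠ z in Filter.cofinite, ‖GQ n a m2 g z‖ < 1 :=
      hGQ1.tendsto_cofinite_zero.eventually (gt_mem_nhds (by norm_num))
    refine Summable.of_norm_bounded_eventually hGQ1 ?_
    filter_upwards [h1] with z hz
    rw [Real.norm_of_nonneg (sq_nonneg _), sq]
    exact mul_le_of_le_one_left (norm_nonneg _) hz.le
  exact B4Eq244L2Unique.opD_injective_l2 n (Nat.succ_pos d) ha.le hm hφ hGQ2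
    fun z => by rw [h z, opD_GQ n ha hm hg z]

/-- **(2.47) FOR THE KERNEL OBJECT AT `m² ≥ 0`**: the transform of `G_jQ_j^*g = Σ_y K(·,y)g(y)` is the printed right-hand side of
(2.47) at every generic reduced momentum `p′` (some coordinate outside `2πℤ`), every shift `l`, for `g ∈ ℓ¹`, `a > 0`, `m² ≥ 0`.
[cite: Balaban1983RegularityDecay, (2.47)–(2.48) p.585] -/
theorem ftSum_fibre_GQ_kernel_of_generic (n : ℕ) [NeZero n] {a m2 : ℝ} (ha : 0 < a) (hm : 0 ≤ m2)
    {g : (Fin (d + 1) → ℤ) → ℂ} (hg : Summable fun y => ‖g y‖) {p : Fin (d + 1) → ℝ} {μ : Fin (d + 1)}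
    (hp : ∀ m : ℤ, p μ ≠ 2 * π * m) (k : Fin (d + 1) → Fin n) :
    ftSum n (GQ n a m2 g) (shift n k (ofRealVec p))
      = V n k (ofRealVec p) / DeltaXi n m2 (shift n k (ofRealVec p))
        * (bracket246 (a : ℂ) (fun k' : Fin (d + 1) → Fin n => DeltaXi n m2 (shift n k' (ofRealVec p)))
            (fun k' => V n k' (ofRealVec p)))⁻¹
        * uft g (ofRealVec p) :=
  ftSum_fibre_GQ_of_generic n ha.le hm (summable_norm_GQ n ha hm hg) hg (opD_GQ n ha hm hg) hp k

end

end Literature.MathematicalPhysics.QuantumFieldTheory.Balaban1983to89.B4Eq247TransformGQ
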